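import Literature.NumberTheory.Transcendental.KontsevichZagier
import HarnessLib

/-!
# Periods family — proofs: countability of the period ring (periods.S05)

Sibling proof file of `KontsevichZagier.lean` (kept separate from `KontsevichZagierProofs.lean`, which
discharges the exponential-period facts of that file). It discharges the named fact

* `Literature.NumberTheory.Transcendental.periods_countable'` (**periods.S05**, Kontsevich–Zagier
  2001, §1.1): the set `P` of effective periods is countable — `periods_countable'_holds`.

## Source and proof architecture

M. Kontsevich, D. Zagier, *Periods* (IHÉS preprint M/01/22, May 2001; in: Mathematics
Unlimited — 2001 and Beyond, Springer 2001), Ch. 1, §1.1, p. 4 of the IHÉS text, immediately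
after the Definition of a period: "We will denote the set of periods by `P`. It is obviously
countable." No proof is printed. The obvious proof — a real period is the value of the integral
attached to a datum `(n, σ, p, q)` with `σ ⊆ ℝⁿ` in the Boolean algebra generated by the
zero sets and positivity sets of the countably many `p ∈ ℚ[x₁, …, xₙ]` and `p, q ∈ ℚ[x₁, …, xₙ]`,
so there are countably many data, and `P` embeds into (real periods)² via `z ↦ (re z, im z)` —
is carried out in the tree in `Literature/NumberTheory/Transcendental/KZPeriods.lean`
(`countable_booleanSubalgebraClosure`, `countable_setOf_isSemialgebraic`,
`countable_setOf_isRealPeriod`, `periods_countable_holds`). The fact `periods_countable'` of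
`KontsevichZagier.lean` is the proposition `periods.Countable`, i.e. literally the fact
`Literature.NumberTheory.Transcendental.periods_countable` of `KZPeriods.lean`, so its discharge is
the already proved `periods_countable_holds`.

## References

* M. Kontsevich, D. Zagier, *Periods*, in: Mathematics Unlimited — 2001 and Beyond (2001), §1.1.
-/

noncomputable section

namespace Literature.NumberTheory.Transcendental

/-- **Discharge of `periods_countable'`** (**periods.S05**; Kontsevich–Zagier 2001, §1.1, right
after the Definition: "We will denote the set of periods by `P`. It is obviously countable.").
The set `P` of effective Kontsevich–Zagier periods is countable: `periods_countable'` unfolds to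
`periods.Countable`, which is the fact `Literature.NumberTheory.Transcendental.periods_countable`,
proved in `KZPeriods.lean` as `periods_countable_holds` (countably many data `(n, σ, p, q)`;
`P ↪ (real periods)²`). [cite: KontsevichZagier2001, §1.1] -/
theorem periods_countable'_holds : periods_countable' :=
  periods_countable_holds

end Literature.NumberTheory.Transcendental
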